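import Summits.Ventures.Crystal3D.LocalLP.SurfaceComposition
import Literature.Geometry.DiscreteGeometry.SphericalIsoperimetric
import Mathlib.Geometry.Euclidean.Angle.Unoriented.TriangleInequality
import HarnessLib

/-!
# The cap input `(L)` at probing radius `1` from the Lévy–Schmidt inequality

HONEST FRAMING. Part of the venture `Summits/Ventures/Crystal3D` (cell `pub-crystal3d`). This file
DERIVES the named input `LevyCapInput 1 F` of `LocalLP/SurfaceComposition.lean`, with the pure
Lévy table `F k = fLevy2 k / 16π` (seat p2's `Inequalities.fLevy2`), from ONE named fact of the
Literature: `Literature.Geometry.DiscreteGeometry.Schmidt1948_sphericalIsoperimetric` (the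
Lévy–Schmidt spherical isoperimetric inequality in the form of Figiel–Lindenstrauss–Milman 1977,
Thm 2.1; NOT proved in the tree). Everything else is proved here: the exposed directions of a ball
with `k` contacts lie in the closed set `W` of directions at angle `≥ π/3` from the `k` contact
directions; the contact directions are pairwise at angle `≥ π/3`, so the closed caps of any
radius `ρ < π/6` about them are pairwise disjoint and disjoint from the `π/6`-neighbourhood of `W`
(triangle inequality for angles); additivity of the cone volume fraction over finitely many
disjoint measurable direction sets gives `σ(W_{π/6}) + k σ(cap ρ) ≤ 1`, hence (letting
`ρ → π/6`) `σ(W_{π/6}) ≤ 1 - k(1 - √3/2)/2`; Lévy–Schmidt bounds `σ(W_{π/6})` below by the cap of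
radius `r + π/6` where `σ(W) = σ(cap r)`; the real-analysis step `cap(r + π/6) ≤ … ⇒ σ(W) ≤
fLevy2 k / 16π` is seat p2's `exposed_le_fLevy2`. No crystallization statement is claimed.
-/

noncomputable section

open scoped BigOperators RealInnerProductSpace Topology
open Finset Real InnerProductGeometry MeasureTheory Set Filter

namespace Summit.Ventures.Crystal3D

open Literature.Geometry.DiscreteGeometry (ballFraction sphereFraction sphCap sphNhd rayCone
  Schmidt1948_sphericalIsoperimetric sphereFraction_sphCap sphereFraction_mono
  sphereFraction_le_one sphereFraction_nonneg sphereFraction_sphere sphCap_of_pi_le rayCone_sphCap)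
open Summit.Ventures.Crystal3D.Inequalities (cθ fLevy2 exposed_le_fLevy2 sqrt_three_bounds)

variable {N : ℕ} {x : Fin N → EuclideanSpace ℝ (Fin 3)}

/-! ## A. Elementary spherical geometry of unit vectors -/

/-- For unit vectors, `‖a - b‖ ≥ 1` gives `⟪a, b⟫ ≤ 1/2`. -/
theorem inner_le_half_of_one_le_norm_sub {a b : EuclideanSpace ℝ (Fin 3)} (ha : ‖a‖ = 1)
    (hb : ‖b‖ = 1) (h : 1 ≤ ‖a - b‖) : ⟪a, b⟫ ≤ 1 / 2 := by
  have h1 : 1 ≤ ‖a - b‖ ^ 2 := by nlinarith [norm_nonneg (a - b)]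
  rw [norm_sub_sq_real, ha, hb] at h1
  linarith

/-- For unit vectors, `⟪a, b⟫ ≤ 1/2` gives angle `≥ π/3`. -/
theorem pi_div_three_le_angle {a b : EuclideanSpace ℝ (Fin 3)} (ha : ‖a‖ = 1) (hb : ‖b‖ = 1)
    (h : ⟪a, b⟫ ≤ 1 / 2) : π / 3 ≤ angle a b := by
  have hcos : cos (angle a b) ≤ cos (π / 3) := by
    rw [cos_angle, ha, hb, mul_one, div_one, cos_pi_div_three]; exact h
  by_contra hlt
  have hlt' : angle a b < π / 3 := not_le.1 hlt
  exact absurd hcos (not_le.2 (Real.cos_lt_cos_of_nonneg_of_le_pi (angle_nonneg a b)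
    (by linarith [pi_pos]) hlt'))

/-! ## B. Contact directions and the uncovered set `W` -/

/-- A contact neighbour gives a unit contact direction `x j - x i`. -/
theorem norm_contactDir {i j : Fin N} (hj : j ∈ contactNeighbors x i) : ‖x j - x i‖ = 1 := by
  rw [← dist_eq_norm, dist_comm]; exact ((mem_contactNeighbors x).1 hj).2

/-- Distinct contact directions of a packing are at angle `≥ π/3`. -/
theorem angle_contactDir_ge (hx : IsUnitPacking x) {i j l : Fin N} (hj : j ∈ contactNeighbors x i)
    (hl : l ∈ contactNeighbors x i) (hjl : j ≠ l) : π / 3 ≤ angle (x j - x i) (x l - x i) := by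
  refine pi_div_three_le_angle (norm_contactDir hj) (norm_contactDir hl)
    (inner_le_half_of_one_le_norm_sub (norm_contactDir hj) (norm_contactDir hl) ?_)
  rw [sub_sub_sub_cancel_right, ← dist_eq_norm]
  exact hx hjl

/-- The **uncovered directions** of ball `i`: unit vectors at angle `≥ π/3` (inner product
`≤ 1/2`) from every contact direction — a closed subset of the sphere containing the exposed cap
at radius `1`. -/
def uncoveredDir (x : Fin N → EuclideanSpace ℝ (Fin 3)) (i : Fin N) :
    Set (EuclideanSpace ℝ (Fin 3)) :=
  {u | ‖u‖ = 1 ∧ ∀ j ∈ contactNeighbors x i, ⟪u, x j - x i⟫ ≤ 1 / 2}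

/-- The exposed cap at radius `1` lies in the uncovered set. -/
theorem exposedCap_one_subset_uncoveredDir (i : Fin N) : exposedCap x 1 i ⊆ uncoveredDir x i := by
  rintro u ⟨hu, hfar⟩
  refine ⟨hu, fun j hj => ?_⟩
  have hji : j ≠ i := ((mem_contactNeighbors x).1 hj).1
  have h1 := hfar j hji
  rw [one_smul, dist_eq_norm] at h1
  have : x i + u - x j = u - (x j - x i) := by abel
  rw [this] at h1
  exact inner_le_half_of_one_le_norm_sub hu (norm_contactDir hj) h1

/-- The uncovered set is closed. -/
theorem isClosed_uncoveredDir (i : Fin N) : IsClosed (uncoveredDir x i) := by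
  have h1 : IsClosed {u : EuclideanSpace ℝ (Fin 3) | ‖u‖ = 1} :=
    isClosed_eq continuous_norm continuous_const
  have h2 : ∀ j : Fin N, IsClosed {u : EuclideanSpace ℝ (Fin 3) | ⟪u, x j - x i⟫ ≤ 1 / 2} :=
    fun j => isClosed_le (continuous_id.inner continuous_const) continuous_const
  have : uncoveredDir x i = {u | ‖u‖ = 1} ∩ ⋂ j ∈ contactNeighbors x i, {u | ⟪u, x j - x i⟫ ≤ 1 / 2} := by
    ext u; simp [uncoveredDir, mem_iInter]
  rw [this]
  exact h1.inter (isClosed_biInter fun j _ => h2 j)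

/-- The uncovered set lies on the unit sphere. -/
theorem uncoveredDir_subset_sphere (i : Fin N) :
    uncoveredDir x i ⊆ {u : EuclideanSpace ℝ (Fin 3) | ‖u‖ = 1} :=
  fun _ hu => hu.1

/-- Points of the `π/6`-neighbourhood of the uncovered set are at angle `≥ π/6` from every
contact direction (triangle inequality). -/
theorem angle_ge_of_mem_sphNhd {i : Fin N} {y : EuclideanSpace ℝ (Fin 3)}
    (hy : y ∈ sphNhd (uncoveredDir x i) (π / 6)) {j : Fin N} (hj : j ∈ contactNeighbors x i) :
    π / 6 ≤ angle (x j - x i) y := by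
  obtain ⟨hy1, w, hw, hyw⟩ := hy
  have h60 : π / 3 ≤ angle w (x j - x i) :=
    pi_div_three_le_angle hw.1 (norm_contactDir hj) (hw.2 j hj)
  have htri : angle (x j - x i) w ≤ angle (x j - x i) y + angle y w :=
    angle_le_angle_add_angle _ _ _
  rw [angle_comm] at h60
  linarith

/-- For `ρ < π/6`, the closed `ρ`-caps about the contact directions miss the neighbourhood. -/
theorem disjoint_sphNhd_sphCap {i : Fin N} {ρ : ℝ} (hρ : ρ < π / 6) {j : Fin N}
    (hj : j ∈ contactNeighbors x i) :
    Disjoint (sphNhd (uncoveredDir x i) (π / 6)) (sphCap (x j - x i) ρ) := by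
  rw [Set.disjoint_left]
  intro y hy hcap
  have := angle_ge_of_mem_sphNhd hy hj
  have h2 : angle (x j - x i) y ≤ ρ := hcap.2
  linarith

/-- For `ρ < π/6`, the closed `ρ`-caps about distinct contact directions are disjoint. -/
theorem disjoint_sphCap_sphCap (hx : IsUnitPacking x) {i : Fin N} {ρ : ℝ} (hρ : ρ < π / 6)
    {j l : Fin N} (hj : j ∈ contactNeighbors x i) (hl : l ∈ contactNeighbors x i) (hjl : j ≠ l) :
    Disjoint (sphCap (x j - x i) ρ) (sphCap (x l - x i) ρ) := by
  rw [Set.disjoint_left]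
  intro y hyj hyl
  have h60 := angle_contactDir_ge hx hj hl hjl
  have htri : angle (x j - x i) (x l - x i) ≤ angle (x j - x i) y + angle y (x l - x i) :=
    angle_le_angle_add_angle _ _ _
  have h1 : angle (x j - x i) y ≤ ρ := hyj.2
  have h2 : angle (x l - x i) y ≤ ρ := hyl.2
  rw [angle_comm] at h2
  linarith

/-! ## C. Additivity of the sphere fraction over disjoint measurable direction sets -/

/-- Disjoint direction sets have disjoint ray cones. -/
theorem disjoint_rayCone {A B : Set (EuclideanSpace ℝ (Fin 3))} (h : Disjoint A B) :
    Disjoint (rayCone A) (rayCone B) := by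
  rw [Set.disjoint_left] at h ⊢
  intro v hvA hvB
  exact h hvA.2 hvB.2

/-- The ray cone of a closed cap about a unit vector is measurable. -/
theorem measurableSet_rayCone_sphCap {a : EuclideanSpace ℝ (Fin 3)} (ha : ‖a‖ = 1) {ρ : ℝ}
    (hρ0 : 0 ≤ ρ) (hρπ : ρ ≤ π) : MeasurableSet (rayCone (sphCap a ρ)) := by
  rw [rayCone_sphCap ha hρ0 hρπ]
  have h1 : IsOpen {v : EuclideanSpace ℝ (Fin 3) | v ≠ 0} := isOpen_ne
  have h2 : IsClosed {v : EuclideanSpace ℝ (Fin 3) | cos ρ * ‖v‖ ≤ ⟪a, v⟫} :=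
    isClosed_le (continuous_const.mul continuous_norm) (continuous_const.inner continuous_id)
  have : {v : EuclideanSpace ℝ (Fin 3) | v ≠ 0 ∧ cos ρ * ‖v‖ ≤ ⟪a, v⟫} =
      {v | v ≠ 0} ∩ {v | cos ρ * ‖v‖ ≤ ⟪a, v⟫} := rfl
  rw [this]
  exact h1.measurableSet.inter h2.measurableSet

/-- **Additivity bound.** For a direction set `A` and finitely many direction sets `C j`
(`j ∈ s`) with measurable ray cones, pairwise disjoint and disjoint from `A`:
`σ(A) + ∑ σ(C j) ≤ 1`. -/
theorem sphereFraction_add_sum_le_one {ι : Type*} (s : Finset ι)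
    (A : Set (EuclideanSpace ℝ (Fin 3))) (C : ι → Set (EuclideanSpace ℝ (Fin 3)))
    (hmeas : ∀ j ∈ s, MeasurableSet (rayCone (C j)))
    (hdisj : ∀ j ∈ s, ∀ l ∈ s, j ≠ l → Disjoint (C j) (C l))
    (hA : ∀ j ∈ s, Disjoint A (C j)) :
    sphereFraction A + ∑ j ∈ s, sphereFraction (C j) ≤ 1 := by
  classical
  set B : Set (EuclideanSpace ℝ (Fin 3)) := Metric.ball 0 1 with hB
  have hVtop : volume B ≠ ⊤ := measure_ball_lt_top.ne
  have hVpos : 0 < (volume B).toReal :=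
    ENNReal.toReal_pos (Metric.measure_ball_pos volume (0 : EuclideanSpace ℝ (Fin 3)) one_pos).ne' hVtop
  -- the pieces inside the ball
  set P : ι → Set (EuclideanSpace ℝ (Fin 3)) := fun j => B ∩ rayCone (C j) with hP
  have hPmeas : ∀ j ∈ s, MeasurableSet (P j) :=
    fun j hj => measurableSet_ball.inter (hmeas j hj)
  have hPdisj : (↑s : Set ι).PairwiseDisjoint P := by
    intro j hj l hl hjl
    exact Disjoint.mono Set.inter_subset_right Set.inter_subset_right
      (disjoint_rayCone (hdisj j hj l hl hjl))
  have hU : volume (⋃ j ∈ s, P j) = ∑ j ∈ s, volume (P j) := measure_biUnion_finset hPdisj hPmeas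
  have hAU : Disjoint (B ∩ rayCone A) (⋃ j ∈ s, P j) := by
    rw [Set.disjoint_iUnion_right]; intro j
    rw [Set.disjoint_iUnion_right]; intro hj
    exact Disjoint.mono Set.inter_subset_right Set.inter_subset_right (disjoint_rayCone (hA j hj))
  have hUmeas : MeasurableSet (⋃ j ∈ s, P j) := MeasurableSet.biUnion s.countable_toSet hPmeas
  have htot : volume (B ∩ rayCone A) + ∑ j ∈ s, volume (P j) ≤ volume B := by
    rw [← hU, ← measure_union hAU hUmeas]
    exact measure_mono (union_subset Set.inter_subset_left
      (iUnion₂_subset fun j _ => Set.inter_subset_left))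
  -- pass to real numbers
  have hfinA : volume (B ∩ rayCone A) ≠ ⊤ :=
    ((measure_mono Set.inter_subset_left).trans_lt measure_ball_lt_top).ne
  have hfinP : ∀ j ∈ s, volume (P j) ≠ ⊤ := fun j _ =>
    ((measure_mono Set.inter_subset_left).trans_lt measure_ball_lt_top).ne
  have hreal : (volume (B ∩ rayCone A)).toReal + ∑ j ∈ s, (volume (P j)).toReal ≤
      (volume B).toReal := by
    rw [← ENNReal.toReal_sum hfinP, ← ENNReal.toReal_add hfinA (ENNReal.sum_ne_top.2 hfinP)]
    exact ENNReal.toReal_mono hVtop htot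
  -- divide by `vol B`
  have hfracA : sphereFraction A = (volume (B ∩ rayCone A)).toReal / (volume B).toReal := rfl
  have hfracC : ∀ j, sphereFraction (C j) = (volume (P j)).toReal / (volume B).toReal := fun j => rfl
  rw [hfracA]
  simp_rw [hfracC]
  rw [← Finset.sum_div, ← add_div, div_le_one hVpos]
  exact hreal

/-! ## D. The neighbourhood bound `σ(W_{π/6}) ≤ 1 - k (1 - √3/2)/2` -/

/-- For every `0 ≤ ρ < π/6`: `σ(W_{π/6}) + k · (1 - cos ρ)/2 ≤ 1`. -/
theorem sphNhd_add_caps_le_one (hx : IsUnitPacking x) (i : Fin N) {ρ : ℝ} (hρ0 : 0 ≤ ρ)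
    (hρ : ρ < π / 6) :
    sphereFraction (sphNhd (uncoveredDir x i) (π / 6)) +
      (coordination x i : ℝ) * ((1 - cos ρ) / 2) ≤ 1 := by
  have hρπ : ρ ≤ π := by linarith [pi_pos]
  have h := sphereFraction_add_sum_le_one (contactNeighbors x i)
    (sphNhd (uncoveredDir x i) (π / 6)) (fun j => sphCap (x j - x i) ρ)
    (fun j hj => measurableSet_rayCone_sphCap (norm_contactDir hj) hρ0 hρπ)
    (fun j hj l hl hjl => disjoint_sphCap_sphCap hx hρ hj hl hjl)
    (fun j hj => disjoint_sphNhd_sphCap hρ hj)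
  have hcaps : ∑ j ∈ contactNeighbors x i, sphereFraction (sphCap (x j - x i) ρ) =
      (coordination x i : ℝ) * ((1 - cos ρ) / 2) := by
    rw [Finset.sum_congr rfl fun j hj => sphereFraction_sphCap (norm_contactDir hj) hρ0 hρπ,
      Finset.sum_const, nsmul_eq_mul, coordination]
  rw [hcaps] at h
  exact h

/-- **Neighbourhood bound**: `σ(W_{π/6}) ≤ 1 - k · (1 - √3/2)/2` (`k` = coordination number),
by letting `ρ → π/6` in the previous lemma. -/
theorem sphereFraction_sphNhd_le (hx : IsUnitPacking x) (i : Fin N) :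
    sphereFraction (sphNhd (uncoveredDir x i) (π / 6)) ≤
      1 - (coordination x i : ℝ) * ((1 - Real.sqrt 3 / 2) / 2) := by
  set σ := sphereFraction (sphNhd (uncoveredDir x i) (π / 6)) with hσ
  set k : ℝ := (coordination x i : ℝ) with hk
  -- the continuous function `ρ ↦ σ + k (1 - cos ρ)/2` is `≤ 1` on `[0, π/6)`, hence at `π/6`
  have hcont : Continuous fun ρ : ℝ => σ + k * ((1 - cos ρ) / 2) :=
    continuous_const.add (continuous_const.mul ((continuous_const.sub continuous_cos).div_const _))
  have hlim : Tendsto (fun ρ : ℝ => σ + k * ((1 - cos ρ) / 2)) (𝓝[<] (π / 6))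
      (𝓝 (σ + k * ((1 - cos (π / 6)) / 2))) :=
    (hcont.tendsto (π / 6)).mono_left nhdsWithin_le_nhds
  have hev : ∀ᶠ ρ in 𝓝[<] (π / 6), σ + k * ((1 - cos ρ) / 2) ≤ 1 := by
    have hpos : (0 : ℝ) < π / 6 := by positivity
    have hmem : Set.Ioo (0 : ℝ) (π / 6) ∈ 𝓝[<] (π / 6) := Ioo_mem_nhdsLT hpos
    filter_upwards [hmem] with ρ hρ
    exact sphNhd_add_caps_le_one hx i hρ.1.le hρ.2
  have hle := le_of_tendsto hlim hev
  rw [cos_pi_div_six] at hle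
  linarith

/-! ## E. The Lévy step and the table -/

/-- `cθ k ∈ [-1, 1]` for `k ≤ 11` (needed to invert the cosine). -/
theorem abs_cθ_le_one {k : ℕ} (hk : k ≤ 11) : -1 ≤ cθ k ∧ cθ k ≤ 1 := by
  obtain ⟨h1, h2⟩ := sqrt_three_bounds
  have hk' : (k : ℝ) ≤ 11 := by exact_mod_cast hk
  have hk0 : (0 : ℝ) ≤ k := Nat.cast_nonneg k
  constructor
  · unfold cθ; nlinarith
  · unfold cθ; nlinarith

/-- `fLevy2 k ≥ 0` for `1 ≤ k ≤ 11`: `g_k = 1 - (√3/2) c - (1/2)√(1 - c²) ≥ 0` by Cauchy–Schwarz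
(`((√3/2) c + (1/2) s)² + ((1/2) c - (√3/2) s)² = c² + s² = 1`). -/
theorem fLevy2_nonneg {k : ℕ} (hk1 : 1 ≤ k) (hk11 : k ≤ 11) : 0 ≤ fLevy2 k := by
  have hπ : 0 < π := pi_pos
  unfold fLevy2
  have hk0 : k ≠ 0 := by omega
  have hk12 : ¬ 12 ≤ k := by omega
  simp only [hk0, hk12, if_false]
  obtain ⟨hc1, hc2⟩ := abs_cθ_le_one hk11
  set c := cθ k with hc
  set sn := Real.sqrt (1 - c ^ 2) with hsn
  have hsq : sn ^ 2 = 1 - c ^ 2 := Real.sq_sqrt (by nlinarith)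
  have h3 : Real.sqrt 3 ^ 2 = 3 := Real.sq_sqrt (by norm_num)
  have ht : (Real.sqrt 3 / 2 * c + 1 / 2 * sn) ^ 2 ≤ 1 := by
    nlinarith [sq_nonneg (1 / 2 * c - Real.sqrt 3 / 2 * sn)]
  have ht1 : Real.sqrt 3 / 2 * c + 1 / 2 * sn ≤ 1 :=
    (abs_le.1 ((sq_le_one_iff_abs_le_one _).1 ht)).2
  have hg : 0 ≤ Inequalities.g k := by
    unfold Inequalities.g
    rw [← hc, ← hsn]
    linarith
  positivity

/-- **The Lévy bound on the uncovered set**: under the Lévy–Schmidt fact, a ball with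
`1 ≤ k ≤ 11` contacts has `σ(W) ≤ fLevy2 k / 16π`. -/
theorem sphereFraction_uncoveredDir_le (hLevy : Schmidt1948_sphericalIsoperimetric)
    (hx : IsUnitPacking x) (i : Fin N) (hk1 : 1 ≤ coordination x i)
    (hk11 : coordination x i ≤ 11) :
    sphereFraction (uncoveredDir x i) ≤ fLevy2 (coordination x i) / (16 * π) := by
  set W := uncoveredDir x i with hW
  set k := coordination x i with hk
  have hπ : 0 < π := pi_pos
  by_cases hne : W.Nonempty
  swap
  · -- empty uncovered set
    rw [Set.not_nonempty_iff_eq_empty] at hne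
    have h0 : sphereFraction W = 0 := by
      rw [hne]
      have : rayCone (∅ : Set (EuclideanSpace ℝ (Fin 3))) = ∅ := by
        ext v; simp [rayCone]
      simp [sphereFraction, this, ballFraction]
    rw [h0]
    have hf : 0 ≤ fLevy2 k := fLevy2_nonneg hk1 hk11
    positivity
  · -- nonempty: choose the cap radius `r` with `σ(W) = σ(cap r)`
    set a₀ := sphereFraction W with ha₀
    have ha₀0 : 0 ≤ a₀ := sphereFraction_nonneg W
    have ha₀1 : a₀ ≤ 1 := sphereFraction_le_one W
    set r := Real.arccos (1 - 2 * a₀) with hr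
    have hr0 : 0 ≤ r := Real.arccos_nonneg _
    have hrπ : r ≤ π := Real.arccos_le_pi _
    have hcosr : cos r = 1 - 2 * a₀ := by
      rw [hr]; exact Real.cos_arccos (by linarith) (by linarith)
    -- a fixed pole
    set e₀ : EuclideanSpace ℝ (Fin 3) := EuclideanSpace.single 0 1 with he₀
    have he₀n : ‖e₀‖ = 1 := by simp [he₀]
    have hcap : sphereFraction W = sphereFraction (sphCap e₀ r) := by
      rw [sphereFraction_sphCap he₀n hr0 hrπ, hcosr]; ring
    -- Lévy–Schmidt
    have hL := hLevy W e₀ r (π / 6) hne (isClosed_uncoveredDir i) (uncoveredDir_subset_sphere i)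
      he₀n hr0 (by positivity) hcap
    have hNbhd := sphereFraction_sphNhd_le hx i
    rw [← hk] at hNbhd
    -- the big cap cannot be the whole sphere (k ≥ 1)
    have hsmall : r + π / 6 ≤ π := by
      by_contra hbig
      have hbig' : π ≤ r + π / 6 := (not_le.1 hbig).le
      have h1 : sphereFraction (sphCap e₀ (r + π / 6)) = 1 := by
        rw [sphCap_of_pi_le e₀ hbig', sphereFraction_sphere]
      rw [h1] at hL
      obtain ⟨hs1, hs2⟩ := sqrt_three_bounds
      have hk1' : (1 : ℝ) ≤ k := by exact_mod_cast hk1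
      have : (0 : ℝ) < k * ((1 - Real.sqrt 3 / 2) / 2) := by
        apply mul_pos (by linarith); nlinarith
      linarith
    have hcapBig : sphereFraction (sphCap e₀ (r + π / 6)) = (1 - cos (r + π / 6)) / 2 :=
      sphereFraction_sphCap he₀n (by positivity) hsmall
    rw [hcapBig] at hL
    -- `harea` in seat p2's normalisation (areas on the radius-2 sphere, total `16π`… their
    -- lemma is stated with `2π(1 - cos)` caps on the unit sphere times `4`)
    have harea : 2 * π * (1 - cos (r + π / 6)) ≤ 4 * π - k * (2 * π * (1 - Real.sqrt 3 / 2)) := by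
      have := hL.trans hNbhd
      nlinarith [hπ]
    -- invert the cosine of `θ_k`
    obtain ⟨hc1, hc2⟩ := abs_cθ_le_one hk11
    set θ := Real.arccos (cθ k) with hθ
    have hθ0 : 0 ≤ θ := Real.arccos_nonneg _
    have hθπ : θ ≤ π := Real.arccos_le_pi _
    have hcθ : cos θ = cθ k := by rw [hθ]; exact Real.cos_arccos hc1 hc2
    have hmain := exposed_le_fLevy2 hk1 hk11 hθ0 hθπ hcθ hr0 hsmall harea
    -- `4 · 2π(1 - cos r) ≤ fLevy2 k` and `a₀ = (1 - cos r)/2`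
    have ha : a₀ = (1 - cos r) / 2 := by rw [hcosr]; ring
    rw [ha, le_div_iff₀ (by positivity)]
    nlinarith [hmain, hπ]

/-- **`(L)` at radius `1` from Lévy–Schmidt.** Under the named fact
`Schmidt1948_sphericalIsoperimetric`, every ball with `k ≤ 11` contacts in a packing of
diameter-`1` balls has exposed fraction at probing radius `1` at most `fLevy2 k / 16π`
(the pure Lévy table: `1` at `k = 0`, `g_k / 2` for `1 ≤ k ≤ 11`). -/
theorem levyCapInput_one (hLevy : Schmidt1948_sphericalIsoperimetric) :
    LevyCapInput 1 (fun k => fLevy2 k / (16 * π)) := by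
  intro N x hx i hk11
  change sphereFraction (exposedCap x 1 i) ≤ fLevy2 (coordination x i) / (16 * π)
  rcases Nat.eq_zero_or_pos (coordination x i) with h0 | hpos
  · -- no contacts: the bound is `16π / 16π = 1`
    rw [h0]
    have : fLevy2 0 / (16 * π) = 1 := by
      rw [show fLevy2 0 = 16 * π by simp [fLevy2]]
      exact div_self (by positivity)
    rw [this]
    exact sphereFraction_le_one _
  · exact (sphereFraction_mono (exposedCap_one_subset_uncoveredDir i)).trans
      (sphereFraction_uncoveredDir_le hLevy hx i hpos hk11)

end Summit.Ventures.Crystal3D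

end
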